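import Mathlib
import HarnessLib
import Literature.Probability.MarkovChains.TotalVariation
import Summits.Ventures.LatticeQCDFlow.Exactness.FlowMCMC
import Summits.Ventures.LatticeQCDFlow.Exactness.FrozenExteriorMarginals

/-!
# Frozen exterior: the stationary path-IMH acceptance is at most `1 − TV(π₁^ext, π₀^ext)`

HONEST FRAMING: exact (Metropolis-corrected) sampling algorithms for lattice gauge theory;
figures of merit are autocorrelation/cost numbers at stated couplings and volumes; no
continuum-physics claim.

Venture `LatticeQCDFlow` (cell pub-lqcd), topic `Exactness`; FANOUT row 8 (`s0-cpn-nemc`, GEN-7).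
NEW WORK of the cell (elementary finite sums), not a published result; nothing is cited as a fact.
Third leg of the frozen-exterior ('defect-ball') floor theorem of the flow seat's
`HOME/canary-flow/ballq/BALL-FLOOR-flow.md` §1, after row 13's first-moment half
(`FrozenExteriorPenalty.lean`: `⟨W⟩ − ΔF ≥ Q = KL(π₀^ext‖π₁^ext)`) and row 8's second-moment half
(`FrozenExteriorESS.lean` / `FrozenExteriorMarginals.lean`: Kish-ESS `≤ e^{−D₂(π₁^ext‖π₀^ext)}`):
the ACCEPTANCE statement.  Uses the tree's independence-Metropolis acceptance functional
`accRate` and T2-E `accRate_le` (`Exactness/FlowMCMC.lean`) and the finite total variation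
`Literature.Probability.MarkovChains.tvDist`.

## Content

The frozen-exterior protocol run as an independence sampler on PATHS (the SNF / NE-MCMC scheme of
`Exactness/PathIMH.lean`: independent evolutions from the prior chain, Metropolis test
`min(1, e^{−(W_new − W_old)})` between consecutive ones) has, on the pair space (exterior, path),
* proposal law `frozenFwdLaw p q (y, ω) = p_y q_{y,ω}` (exterior marginal `p`,
  `fstMarginal_frozenFwdLaw`), and
* target law `frozenTiltedLaw p q W (y, ω) = p_y q_{y,ω} e^{−W_{y,ω}} / Σ p q e^{−W}` — the
  work-tilted path law, whose weight against the proposal is `∝ e^{−W}`; under per-exterior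
  Jarzynski its exterior marginal is the TARGET marginal `exteriorTarget p ΔF`
  (`fstMarginal_frozenTiltedLaw`).

* `tvDist_fstMarginal_le` — DATA PROCESSING for the finite total variation under marginalisation
  (`|Σ_ω (A − B)| ≤ Σ_ω |A − B|`);
* **`accRate_frozen_le_one_sub_tvDist`** — the stationary mean acceptance of the path sampler is at
  most `1 − tvDist (exteriorTarget p ΔF) p` for EVERY number of steps and every exterior-freezing
  interior kernel: T2-E on the pair space, then data processing down to the exterior;
* `tvDist_exteriorTarget_eq` — the bound in closed form,
  `TV(π₁^ext, π₀^ext) = ½ Σ_y p_y |e^{annealedDeltaF − ΔF(y)} − 1|`, a function of the prior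
  exterior weights and the conditional free-energy differences only (estimable from the same
  quenched-scan sample `ΔF(y_i)` that gives `Q` and the Kish ceiling).

Reading: like the floor `Q` and the Kish ceiling, the acceptance cap is a property of the OUTERMOST
region ever swept; the flow seat's Gaussian-regime value `2Φ(−√(Q/2))` (0.70 at Q = 0.29) is their
dictionary, not typed here.
-/

namespace Summit.Ventures.LatticeQCDFlow.Exactness

open Finset Real
open Literature.Probability.MarkovChains (tvDist)

section FrozenExteriorAcceptance

variable {Y : Type*} [Fintype Y] {Ω : Type*} [Fintype Ω]

/-! ## Marginalisation contracts total variation -/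

/-- The exterior (first-coordinate) marginal of a law on the pair space `Y × Ω`. -/
def fstMarginal (A : Y × Ω → ℝ) (y : Y) : ℝ := ∑ ω, A (y, ω)

/-- DATA PROCESSING for the finite total variation: marginalising onto the exterior can only
decrease `tvDist`. -/
theorem tvDist_fstMarginal_le (A B : Y × Ω → ℝ) :
    tvDist (fstMarginal A) (fstMarginal B) ≤ tvDist A B := by
  unfold tvDist fstMarginal
  rw [Fintype.sum_prod_type]
  refine mul_le_mul_of_nonneg_left (Finset.sum_le_sum fun y _ => ?_) (by norm_num)
  rw [← Finset.sum_sub_distrib]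
  exact Finset.abs_sum_le_sum_abs _ _

/-! ## The two path laws of the frozen-exterior sampler -/

/-- FORWARD (proposal) law of the frozen-exterior protocol on (exterior, path): `p_y q_{y,ω}`. -/
def frozenFwdLaw (p : Y → ℝ) (q : Y → Ω → ℝ) : Y × Ω → ℝ := fun z => p z.1 * q z.1 z.2

/-- WORK-TILTED (target) law `p_y q_{y,ω} e^{−W_{y,ω}} / Σ_{y,ω} p q e^{−W}`: the law the path
independence sampler with weights `e^{−W}` leaves invariant (cf. `Exactness/PathIMH.lean`). -/
noncomputable def frozenTiltedLaw (p : Y → ℝ) (q W : Y → Ω → ℝ) : Y × Ω → ℝ :=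
  fun z => p z.1 * q z.1 z.2 * Real.exp (-W z.1 z.2) /
    ∑ y, p y * ∑ ω, q y ω * Real.exp (-W y ω)

omit [Fintype Y] in
/-- The proposal law's exterior marginal is the prior marginal `p`. -/
theorem fstMarginal_frozenFwdLaw (p : Y → ℝ) {q : Y → Ω → ℝ} (hqs : ∀ y, ∑ ω, q y ω = 1) :
    fstMarginal (frozenFwdLaw p q) = p := by
  funext y
  simp only [fstMarginal, frozenFwdLaw]
  rw [← Finset.mul_sum, hqs y, mul_one]

/-- The proposal law is a probability vector. -/
theorem sum_frozenFwdLaw {p : Y → ℝ} {q : Y → Ω → ℝ} (hsum : ∑ y, p y = 1)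
    (hqs : ∀ y, ∑ ω, q y ω = 1) : ∑ z, frozenFwdLaw p q z = 1 := by
  rw [Fintype.sum_prod_type]
  have h : ∀ y, ∑ ω, frozenFwdLaw p q (y, ω) = p y := fun y => by
    have := congrFun (fstMarginal_frozenFwdLaw p hqs) y
    simpa only [fstMarginal] using this
  simp only [h, hsum]

/-- Under per-exterior Jarzynski the tilted law's normaliser is the mixture partition sum
`Σ_y p_y e^{−ΔF(y)}`. -/
theorem tiltedNormaliser_eq {p : Y → ℝ} {q W : Y → Ω → ℝ} {dF : Y → ℝ}
    (hJ : ∀ y, ∑ ω, q y ω * Real.exp (-W y ω) = Real.exp (-dF y)) :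
    ∑ y, p y * ∑ ω, q y ω * Real.exp (-W y ω) = ∑ y, p y * Real.exp (-dF y) :=
  Finset.sum_congr rfl fun y _ => by rw [hJ y]

/-- Under per-exterior Jarzynski the tilted law's exterior marginal is the TARGET marginal
`exteriorTarget p ΔF`. -/
theorem fstMarginal_frozenTiltedLaw {p : Y → ℝ} {q W : Y → Ω → ℝ} {dF : Y → ℝ}
    (hJ : ∀ y, ∑ ω, q y ω * Real.exp (-W y ω) = Real.exp (-dF y)) :
    fstMarginal (frozenTiltedLaw p q W) = exteriorTarget p dF := by
  funext y
  simp only [fstMarginal, frozenTiltedLaw, exteriorTarget]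
  rw [← Finset.sum_div, tiltedNormaliser_eq hJ]
  congr 1
  have h : ∀ ω, p y * q y ω * Real.exp (-W y ω) = p y * (q y ω * Real.exp (-W y ω)) :=
    fun ω => by ring
  simp only [h]
  rw [← Finset.mul_sum, hJ y]

/-- Under per-exterior Jarzynski (probability weights `p`) the tilted law is a probability vector. -/
theorem sum_frozenTiltedLaw {p : Y → ℝ} {q W : Y → Ω → ℝ} {dF : Y → ℝ} (hp : ∀ y, 0 ≤ p y)
    (hsum : ∑ y, p y = 1)
    (hJ : ∀ y, ∑ ω, q y ω * Real.exp (-W y ω) = Real.exp (-dF y)) :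
    ∑ z, frozenTiltedLaw p q W z = 1 := by
  rw [Fintype.sum_prod_type]
  have h : ∀ y, ∑ ω, frozenTiltedLaw p q W (y, ω) = exteriorTarget p dF y := fun y => by
    have := congrFun (fstMarginal_frozenTiltedLaw (p := p) hJ) y
    simpa only [fstMarginal] using this
  simp only [h]
  exact sum_exteriorTarget hp hsum

/-! ## The acceptance cap -/

/-- **THE ACCEPTANCE CAP OF A FROZEN-EXTERIOR PROTOCOL.**  With prior exterior weights `p`
(a probability vector), probability rows `q_y` and per-exterior Jarzynski, the stationary mean
acceptance of the path independence sampler (target = work-tilted law, proposal = forward law) is at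
most `1 − TV(π₁^ext, π₀^ext)` — for EVERY number of steps and every exterior-freezing interior
kernel.  T2-E (`accRate_le`) on the pair space, then `tvDist_fstMarginal_le`. -/
theorem accRate_frozen_le_one_sub_tvDist {p : Y → ℝ} {q W : Y → Ω → ℝ} {dF : Y → ℝ}
    (hp : ∀ y, 0 ≤ p y) (hsum : ∑ y, p y = 1) (hqs : ∀ y, ∑ ω, q y ω = 1)
    (hJ : ∀ y, ∑ ω, q y ω * Real.exp (-W y ω) = Real.exp (-dF y)) :
    accRate (frozenTiltedLaw p q W) (frozenFwdLaw p q)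
      ≤ 1 - tvDist (exteriorTarget p dF) p := by
  classical
  have h1 := accRate_le (sum_frozenTiltedLaw hp hsum hJ) (sum_frozenFwdLaw hsum hqs)
  have h2 := tvDist_fstMarginal_le (frozenTiltedLaw p q W) (frozenFwdLaw p q)
  rw [fstMarginal_frozenTiltedLaw hJ, fstMarginal_frozenFwdLaw p hqs] at h2
  linarith

/-- The cap in closed form: `TV(π₁^ext, π₀^ext) = ½ Σ_y p_y |e^{annealedDeltaF − ΔF(y)} − 1|`, a
function of the prior exterior weights and the conditional free-energy differences only. -/
theorem tvDist_exteriorTarget_eq {p dF : Y → ℝ} (hp : ∀ y, 0 ≤ p y) (hsum : ∑ y, p y = 1) :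
    tvDist (exteriorTarget p dF) p
      = (1 / 2) * ∑ y, p y * |Real.exp (annealedDeltaF p dF - dF y) - 1| := by
  unfold tvDist
  congr 1
  refine Finset.sum_congr rfl fun y _ => ?_
  rw [exteriorTarget_eq hp hsum y, ← abs_of_nonneg (hp y), ← abs_mul, abs_of_nonneg (hp y)]
  congr 1
  ring

/-- Packaged: acceptance `≤ 1 − ½ Σ_y p_y |e^{annealedDeltaF − ΔF(y)} − 1|`. -/
theorem accRate_frozen_le_closedForm {p : Y → ℝ} {q W : Y → Ω → ℝ} {dF : Y → ℝ}
    (hp : ∀ y, 0 ≤ p y) (hsum : ∑ y, p y = 1) (hqs : ∀ y, ∑ ω, q y ω = 1)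
    (hJ : ∀ y, ∑ ω, q y ω * Real.exp (-W y ω) = Real.exp (-dF y)) :
    accRate (frozenTiltedLaw p q W) (frozenFwdLaw p q)
      ≤ 1 - (1 / 2) * ∑ y, p y * |Real.exp (annealedDeltaF p dF - dF y) - 1| := by
  rw [← tvDist_exteriorTarget_eq hp hsum]
  exact accRate_frozen_le_one_sub_tvDist hp hsum hqs hJ

end FrozenExteriorAcceptance

end Summit.Ventures.LatticeQCDFlow.Exactness
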